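import Literature.GroupTheory.CombinatorialGroupTheory.CommutatorLengthNPMembership
import Literature.GroupTheory.CombinatorialGroupTheory.CommutatorLength
import Literature.GroupTheory.CombinatorialGroupTheory.CommutatorLengthCertificate
import HarnessLib

/-!
# CL-`F_r` is in `NP` (Heuer 2020, Cor. 2.5), II: cycle-minima, good certificates, assembly

Sequel of `CommutatorLengthNPMembership.lean` (the `FP` verifier `CLNP.verifT` and its truth
`verifT_code_true_iff`: the certificate list `l` is good, `CLNP.GoodCert w k l` — `n` numbers
below `n` forming a fixed-point-free involution pairing inverse letters, and
`n + 2 ≤ 4k + 2 · CLNP.cntL l`, `cntL` the number of minima of the cycles of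
`τ j = l[(j+1) mod n]`). Here:

* **cycle-minima count the cycles**: for a permutation `g` of `Fin n`, every point returns within
  `n` steps (`exists_pos_pow_apply_eq_self`, pigeonhole), the orbit is the set of the first `n`
  iterates (`mem_cls_iff_exists_pow`), and the number of orbits `PairingGenus.ncl g`
  (`CommutatorLength.lean`, `= orbitCount g`) is the number of orbit-minima
  (`ncl_eq_card_filter_isOrbitMin`, orbit `↦` its least element);
* **good certificates are pairings with the genus inequality** (`exists_goodCert_iff`): the
  vertex permutation `(finRotate n).trans π` of [Heuer2020, Thm 2.4] read on the value list of `π`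
  is `τ` (`val_pow_trans_eq_iterate_tauL`), so `cntL l = orb(σπ)`, and a paired word has even
  length (`n + 2 ≤ 4k + 2 orb ↔ n/2 + 1 ≤ 2k + orb`);
* **assembly** `CLNP.clLanguage_eq_inter : clLanguage r = codeLang r ⊓ witnessLang r` through the
  pairing-certificate characterisation `mem_clDecisionSet_iff_exists_isPairing`
  (`CommutatorLengthCertificate.lean`: a yes-instance is an empty word or a word with a pairing
  `π`, `|w|/2 + 1 ≤ 2k + orb(σπ)`), and **`clLanguage_mem_NP : clLanguage r ∈ NP`** for every
  `r` by `inter_P_mem_polyExists` — the `NP`-membership conjunct of the named fact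
  `Heuer2020_clNPComplete` (`CommutatorLengthNP.lean`), whose other conjunct (NP-hardness under
  polynomial-time Turing reductions, via 3-PARTITION and the cyclic block interchange distance,
  [Heuer2020, Thms 2 and 3]) is not addressed here beyond the bookkeeping
  `Heuer2020_clNPComplete_iff_hard` (the fact is now equivalent to its hardness conjunct; with the
  rank step of `CommutatorLengthNPRank.lean`, to `NP ⊆ P^{CL-F₂}`).

## References

* [Heuer2020] N. Heuer, *Computing commutator length is hard*, arXiv:2001.10230, §1 (CL-`G`),
  Thm 2.4, Cor 2.5.
* [AroraBarakCC2009] S. Arora, B. Barak, *Computational Complexity: A Modern Approach*, CUP 2009,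
  Def. 2.1 (`NP` by certificates), §1.3.
-/

noncomputable section

namespace Literature.GroupTheory.CombinatorialGroupTheory

namespace CLNP

open _root_.Computability Literature.Computability.Complexity Literature.Computability.Complexity.Brick
  Literature.Computability.Complexity.HashBricks Literature.Computability.Complexity.Plumb
  Literature.Computability.Complexity.OracleCompose Polynomial

/-! ### Cycle-minima count the cycles -/

section Minima

open Equiv Equiv.Perm PairingGenus

variable {n : ℕ} (g : Perm (Fin n))

/-- Every point returns to itself within `n` steps. [folklore] -/
theorem exists_pos_pow_apply_eq_self (j : Fin n) : ∃ p, 0 < p ∧ p ≤ n ∧ (g ^ p) j = j := by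
  classical
  have hcard : Fintype.card (Fin n) < Fintype.card (Fin (n + 1)) := by simp
  obtain ⟨a, b, hne, hab⟩ := Fintype.exists_ne_map_eq_of_card_lt (fun t : Fin (n + 1) => (g ^ t.val) j) hcard
  have key : ∀ a b : Fin (n + 1), a.val < b.val → (g ^ a.val) j = (g ^ b.val) j →
      ∃ p, 0 < p ∧ p ≤ n ∧ (g ^ p) j = j := by
    intro a b hlt hab
    refine ⟨b.val - a.val, by omega, by have := b.isLt; omega, ?_⟩
    have : (g ^ a.val) ((g ^ (b.val - a.val)) j) = (g ^ a.val) j := by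
      rw [← Perm.mul_apply, ← pow_add, Nat.add_sub_cancel' hlt.le]
      exact hab.symm
    exact (g ^ a.val).injective this
  rcases Nat.lt_or_gt_of_ne (Fin.val_ne_of_ne hne) with h | h
  · exact key a b h hab
  · exact key b a h hab.symm

/-- The orbit of `j` is the set of its first `n` iterates. [folklore] -/
theorem mem_cls_iff_exists_pow (j y : Fin n) : y ∈ cls g j ↔ ∃ t < n, (g ^ t) j = y := by
  rw [mem_cls]
  constructor
  · intro h
    obtain ⟨t, -, rfl⟩ := h.exists_pow_eq'
    obtain ⟨p, hp, hpn, hpj⟩ := exists_pos_pow_apply_eq_self g j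
    refine ⟨t % p, (Nat.mod_lt t hp).trans_le hpn, ?_⟩
    have hper : ∀ m, (g ^ (p * m)) j = j := by
      intro m
      induction m with
      | zero => simp
      | succ m ih => rw [Nat.mul_succ, pow_add, Perm.mul_apply, hpj, ih]
    conv_rhs => rw [← Nat.mod_add_div t p, pow_add, Perm.mul_apply, hper]
  · rintro ⟨t, -, rfl⟩
    exact (sameCycle_pow_right (f := g) (n := t)).2 (SameCycle.refl g j)

/-- `j` is the least point among its first `n` iterates (equivalently, of its orbit). [folklore] -/
def IsOrbitMin (j : Fin n) : Prop := ∀ t < n, j ≤ (g ^ t) j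

/-- `IsOrbitMin` is decidable. [folklore] -/
instance (j : Fin n) : Decidable (IsOrbitMin g j) := by unfold IsOrbitMin; infer_instance

/-- The minimality test over iterates is minimality over the orbit. [folklore] -/
theorem isOrbitMin_iff (j : Fin n) : IsOrbitMin g j ↔ ∀ y ∈ cls g j, j ≤ y := by
  constructor
  · intro h y hy
    obtain ⟨t, ht, rfl⟩ := (mem_cls_iff_exists_pow g j y).1 hy
    exact h t ht
  · intro h t ht
    exact h _ ((mem_cls_iff_exists_pow g j _).2 ⟨t, ht, rfl⟩)

/-- **The number of orbits is the number of orbit-minima.** [folklore] -/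
theorem ncl_eq_card_filter_isOrbitMin : ncl g = (Finset.univ.filter (IsOrbitMin g)).card := by
  classical
  unfold ncl
  symm
  refine Finset.card_bij (fun j _ => cls g j) (fun j _ => Finset.mem_image_of_mem _ (Finset.mem_univ _))
    (fun j₁ hj₁ j₂ hj₂ h => ?_) (fun C hC => ?_)
  · rw [Finset.mem_filter] at hj₁ hj₂
    have h12 : j₂ ∈ cls g j₁ := by rw [h]; exact mem_cls_self g j₂
    have h21 : j₁ ∈ cls g j₂ := by rw [← h]; exact mem_cls_self g j₁
    exact le_antisymm ((isOrbitMin_iff g j₁).1 hj₁.2 _ h12) ((isOrbitMin_iff g j₂).1 hj₂.2 _ h21)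
  · obtain ⟨x, -, rfl⟩ := Finset.mem_image.1 hC
    have hne : (cls g x).Nonempty := ⟨x, mem_cls_self g x⟩
    have hm : (cls g x).min' hne ∈ cls g x := Finset.min'_mem _ _
    have hcls : cls g ((cls g x).min' hne) = cls g x := cls_eq_cls_iff.2 (mem_cls.1 hm).symm
    refine ⟨(cls g x).min' hne, ?_, hcls⟩
    rw [Finset.mem_filter]
    refine ⟨Finset.mem_univ _, (isOrbitMin_iff g _).2 fun y hy => Finset.min'_le _ _ ?_⟩
    rw [hcls] at hy
    exact hy

end Minima

/-! ### Good certificates are pairings with the genus inequality -/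

section Bridge

open Equiv Equiv.Perm PairingGenus

variable {r : ℕ}

/-- A fixed-point-free involution lives on an even number of points. [folklore] -/
theorem two_dvd_length_of_isPairing {w : List (Fin r × Bool)} {π : Perm (Fin w.length)}
    (h : IsPairing w π) : 2 ∣ w.length := by
  have hsq : π ^ 2 = 1 := by
    ext i
    simp [sq, Perm.mul_apply, h.1 i]
  have hsupp : π.support = Finset.univ := by
    ext i
    simp [Perm.mem_support, h.2.1 i]
  have := two_dvd_card_support hsq
  rwa [hsupp, Finset.card_univ, Fintype.card_fin] at this

/-- Value of the cyclic shift modulo the length. [folklore] -/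
theorem val_finRotate_eq_mod {n : ℕ} (i : Fin n) : ((finRotate n) i).val = (i.val + 1) % n := by
  cases n with
  | zero => exact i.elim0
  | succ m =>
    rw [coe_finRotate]
    by_cases h : i = Fin.last m
    · subst h
      simp
    · rw [if_neg h]
      have : i.val < m := by
        have := i.isLt
        have hne : i.val ≠ m := fun h' => h (Fin.ext (by rw [Fin.val_last]; exact h'))
        omega
      rw [Nat.mod_eq_of_lt (by omega)]

/-- The iterates of the vertex permutation `σπ`, read on the certificate list, are the iterates
of `tauL`. [folklore] -/
theorem val_pow_trans_eq_iterate_tauL {w : List (Fin r × Bool)} (π : Perm (Fin w.length)) (l : List ℕ)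
    (hl : l.length = w.length) (hπl : ∀ j : Fin w.length, (π j).val = l[j.val]'(by rw [hl]; exact j.isLt)) :
    ∀ (t : ℕ) (j : Fin w.length), ((((finRotate w.length).trans π) ^ t) j).val = (tauL l)^[t] j.val
  | 0, j => rfl
  | t + 1, j => by
    rw [pow_succ', Perm.mul_apply, Function.iterate_succ_apply',
      ← val_pow_trans_eq_iterate_tauL π l hl hπl t j]
    set i := (((finRotate w.length).trans π) ^ t) j with hi
    rw [Equiv.trans_apply, hπl]
    unfold tauL
    have hn : 0 < w.length := Fin.pos j
    have hidx : (i.val + 1) % l.length < l.length := by rw [hl]; exact Nat.mod_lt _ hn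
    rw [List.getD_eq_getElem _ _ hidx]
    simp only [val_finRotate_eq_mod, hl]

/-- Orbit-minimality of `σπ` is `IsMinL` of the certificate list. [folklore] -/
theorem isOrbitMin_iff_isMinL {w : List (Fin r × Bool)} (π : Perm (Fin w.length)) (l : List ℕ)
    (hl : l.length = w.length) (hπl : ∀ j : Fin w.length, (π j).val = l[j.val]'(by rw [hl]; exact j.isLt))
    (j : Fin w.length) : IsOrbitMin ((finRotate w.length).trans π) j ↔ IsMinL l j.val := by
  unfold IsOrbitMin IsMinL
  rw [hl]
  refine forall_congr' fun t => imp_congr_right fun _ => ?_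
  rw [Fin.le_def, val_pow_trans_eq_iterate_tauL π l hl hπl t j]

/-- The count over `Fin n` is the list count `cntL`. [folklore] -/
theorem card_filter_isOrbitMin_eq_cntL {w : List (Fin r × Bool)} (π : Perm (Fin w.length)) (l : List ℕ)
    (hl : l.length = w.length) (hπl : ∀ j : Fin w.length, (π j).val = l[j.val]'(by rw [hl]; exact j.isLt)) :
    (Finset.univ.filter (IsOrbitMin ((finRotate w.length).trans π))).card = cntL l := by
  classical
  rw [cntL, hl]
  have hf : (Finset.univ.filter (IsOrbitMin ((finRotate w.length).trans π))) =
      Finset.univ.filter fun j : Fin w.length => IsMinL l j.val := by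
    ext j
    simp only [Finset.mem_filter, Finset.mem_univ, true_and]
    exact isOrbitMin_iff_isMinL π l hl hπl j
  rw [hf]
  have hatt : (Finset.univ.filter fun j : Fin w.length => IsMinL l j.val) =
      ((Finset.range w.length).filter fun j => IsMinL l j).attachFin
        (fun m hm => Finset.mem_range.1 (Finset.mem_filter.1 hm).1) := by
    ext j
    simp [Finset.mem_attachFin]
  rw [hatt, Finset.card_attachFin]
  rfl

end Bridge

section GoodCertIff

open Equiv Equiv.Perm PairingGenus

variable {r : ℕ}

/-- **Soundness of the certificate**: a good certificate list is a pairing of the word satisfying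
the genus inequality `|w|/2 + 1 ≤ 2k + orb(σπ)`. [cite: Heuer2020, Cor 2.5] -/
theorem exists_isPairing_of_goodCert {w : List (Fin r × Bool)} {k : ℕ} {l : List ℕ} (hg : GoodCert w k l) :
    ∃ π : Perm (Fin w.length), IsPairing w π ∧
      w.length / 2 + 1 ≤ 2 * k + orbitCount ((finRotate w.length).trans π) := by
  obtain ⟨hl, h, hinv, hlet, hineq⟩ := hg
  set f : Fin w.length → Fin w.length := fun j => ⟨l[j.val]'(by rw [hl]; exact j.isLt),
    h _ (List.getElem_mem _)⟩ with hf
  have hfv : ∀ j, (f j).val = l[j.val]'(by rw [hl]; exact j.isLt) := fun j => rfl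
  have hinvol : Function.Involutive f := by
    intro j
    apply Fin.ext
    rw [hfv]
    simp only [hfv]
    exact (hinv j.val (by rw [hl]; exact j.isLt)).1
  set π : Perm (Fin w.length) := hinvol.toPerm f with hπ
  have hπv : ∀ j : Fin w.length, (π j).val = l[j.val]'(by rw [hl]; exact j.isLt) := fun j => rfl
  refine ⟨π, ⟨fun i => hinvol i, fun i hi => ?_, fun i => ?_⟩, ?_⟩
  · have := congrArg Fin.val hi
    rw [hπv] at this
    exact (hinv i.val (by rw [hl]; exact i.isLt)).2 this
  · rw [List.get_eq_getElem, List.get_eq_getElem]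
    have e := hlet i.val (by rw [hl]; exact i.isLt)
    convert e using 2
    exact hπv i
  · rw [orbitCount_eq_ncl, ncl_eq_card_filter_isOrbitMin, card_filter_isOrbitMin_eq_cntL π l hl hπv]
    omega

/-- **Completeness of the certificate**: a pairing with the genus inequality gives a good
certificate list (its list of values). [cite: Heuer2020, Cor 2.5] -/
theorem exists_goodCert_of_isPairing {w : List (Fin r × Bool)} {k : ℕ} {π : Perm (Fin w.length)}
    (hπ : IsPairing w π) (hb : w.length / 2 + 1 ≤ 2 * k + orbitCount ((finRotate w.length).trans π)) :
    ∃ l : List ℕ, GoodCert w k l := by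
  set l : List ℕ := List.ofFn fun j : Fin w.length => (π j).val with hl
  have hlen : l.length = w.length := by simp [hl]
  have hget : ∀ (j : ℕ) (hj : j < w.length), l[j]'(by rw [hlen]; exact hj) = (π ⟨j, hj⟩).val := by
    intro j hj
    simp [hl]
  have h : ∀ v ∈ l, v < w.length := by
    intro v hv
    rw [hl, List.mem_ofFn] at hv
    obtain ⟨j, rfl⟩ := hv
    exact (π j).isLt
  have hπv : ∀ j : Fin w.length, (π j).val = l[j.val]'(by rw [hlen]; exact j.isLt) := fun j => by
    rw [hget j.val j.isLt]
  refine ⟨l, hlen, h, fun j hj => ?_, fun j hj => ?_, ?_⟩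
  · have hj' : j < w.length := by rw [← hlen]; exact hj
    have e1 : l[j] = (π ⟨j, hj'⟩).val := hget j hj'
    constructor
    · have e2 := hget (π ⟨j, hj'⟩).val (π ⟨j, hj'⟩).isLt
      simp only [Fin.eta, hπ.1] at e2
      simp only [e1]
      exact e2
    · rw [e1]
      intro h'
      exact hπ.2.1 ⟨j, hj'⟩ (Fin.ext h')
  · have hj' : j < w.length := by rw [← hlen]; exact hj
    have e1 : l[j] = (π ⟨j, hj'⟩).val := hget j hj'
    have e := hπ.2.2 ⟨j, hj'⟩
    rw [List.get_eq_getElem, List.get_eq_getElem] at e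
    simp only [e1]
    exact e
  · have hcnt : orbitCount ((finRotate w.length).trans π) = cntL l := by
      rw [orbitCount_eq_ncl, ncl_eq_card_filter_isOrbitMin, card_filter_isOrbitMin_eq_cntL π l hlen hπv]
    obtain ⟨m, hm⟩ := two_dvd_length_of_isPairing hπ
    rw [hcnt] at hb
    omega

/-- **Good certificates are exactly pairings with the genus inequality.** [cite: Heuer2020, Cor 2.5] -/
theorem exists_goodCert_iff (w : List (Fin r × Bool)) (k : ℕ) :
    (∃ l : List ℕ, GoodCert w k l) ↔ ∃ π : Perm (Fin w.length), IsPairing w π ∧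
      w.length / 2 + 1 ≤ 2 * k + orbitCount ((finRotate w.length).trans π) :=
  ⟨fun ⟨_, hg⟩ => exists_isPairing_of_goodCert hg, fun ⟨_, hπ, hb⟩ => exists_goodCert_of_isPairing hπ hb⟩

end GoodCertIff

/-! ### `CL-F_r ∈ NP` -/

section Assembly

open Equiv

variable (r : ℕ)

/-- **The certificate form of CL-`F_r` over `codeLang`** (witness length `≤ 2|x|² + 4|x| + 2`).
[cite: AroraBarakCC2009, Def. 2.1] -/
def witnessLang : Language Bool :=
  {x | ∃ y : List Bool, y.length ≤ (C 2 * X ^ 2 + C 4 * X + C 2 : Polynomial ℕ).eval x.length ∧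
    boolPair x y ∈ verifLang r}

/-- `witnessLang ∈ NP`. [cite: AroraBarakCC2009, Def. 2.1] -/
theorem witnessLang_mem_NP : witnessLang r ∈ Nondeterministic.NP :=
  ⟨verifLang r, verifLang_mem_P r, C 2 * X ^ 2 + C 4 * X + C 2, fun _ => Iff.rfl⟩

/-- An instance code is at least as long as its number of letters. [folklore] -/
theorem length_le_code (w : List (Fin r × Bool)) (k : ℕ) : w.length ≤ (clInstanceCode r (w, k)).length := by
  rw [clInstanceCode, length_boolPair, length_clWordCode]
  nlinarith

/-- **CL-`F_r` is the intersection of the instance-code language with the certificate language**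
(through the pairing-certificate characterisation `mem_clDecisionSet_iff_exists_isPairing` of
`CommutatorLengthCertificate.lean` and `exists_goodCert_iff`). [cite: Heuer2020, Cor 2.5] -/
theorem clLanguage_eq_inter : clLanguage r = codeLang r ⊓ witnessLang r := by
  ext x
  constructor
  · rintro ⟨⟨w, k⟩, hmem, rfl⟩
    refine ⟨(mem_codeLang_iff r _).2 ⟨w, k, rfl⟩, ?_⟩
    rcases (mem_clDecisionSet_iff_exists_isPairing w k).1 hmem with rfl | ⟨π, hπ, hb⟩
    · refine ⟨[], by simp, ?_⟩
      change verifT r _ = [true]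
      rw [verifT_code_true_iff]
      exact Or.inl rfl
    · obtain ⟨l, hg⟩ := exists_goodCert_of_isPairing hπ hb
      obtain ⟨hl, h, -⟩ := id hg
      refine ⟨HamNP.listCode l, ?_, ?_⟩
      · have h1 := HamNP.length_listCode_le hl h
        have h2 := length_le_code r w k
        simp only [eval_add, eval_mul, eval_C, eval_X, eval_pow]
        nlinarith
      · change verifT r _ = [true]
        rw [verifT_code_true_iff]
        exact Or.inr ⟨l, rfl, hg⟩
  · rintro ⟨hcode, y, -, hacc⟩
    obtain ⟨w, k, rfl⟩ := (mem_codeLang_iff r x).1 hcode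
    change verifT r _ = [true] at hacc
    rw [verifT_code_true_iff] at hacc
    refine ⟨(w, k), ?_, rfl⟩
    rw [mem_clDecisionSet_iff_exists_isPairing]
    rcases hacc with h0 | ⟨l, -, hg⟩
    · exact Or.inl h0
    · exact Or.inr (exists_isPairing_of_goodCert hg)

/-- **CL-`F_r ∈ NP`** ([Heuer2020, Cor 2.5]: "CL-`F` is in NP, where the input size is measured in
the wordlength of a free basis of `F`" — the certificate is a pairing, orbits are counted in
polynomial time): a `P` language intersected with a language in certificate form over a `P`
verifier (`inter_P_mem_polyExists`). [cite: Heuer2020, Cor 2.5] -/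
theorem clLanguage_mem_NP : clLanguage r ∈ Nondeterministic.NP := by
  rw [clLanguage_eq_inter]
  exact inter_P_mem_polyExists (K := Classes.P) (fun _ _ a b => inter_mem_P a b) (codeLang_mem_P r)
    (witnessLang_mem_NP r)

end Assembly

end CLNP

/-- **CL-`F_r ∈ NP`** for every rank `r` ([Heuer2020, Cor 2.5]); in particular the first
conjunct of `Heuer2020_clNPComplete r hr`. [cite: Heuer2020, Cor 2.5] -/
theorem clLanguage_mem_NP (r : ℕ) : clLanguage r ∈ Literature.Computability.Complexity.Nondeterministic.NP :=
  CLNP.clLanguage_mem_NP r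

open Literature.Computability.Complexity in
/-- **What remains of the named fact.** With the membership conjunct proved (`clLanguage_mem_NP`),
`Heuer2020_clNPComplete` is equivalent to its hardness conjunct alone: every `NP` language is
polynomial-time Turing-reducible to CL-`F_r`, for every `r ≥ 2` ([Heuer2020, Thm. 3 with
Thm. 2 (ii)]; not proved in the tree). [cite: Heuer2020, Thm. 1 and §5] -/
theorem Heuer2020_clNPComplete_iff_hard :
    Heuer2020_clNPComplete ↔
      ∀ r : ℕ, 2 ≤ r → Nondeterministic.NP ⊆ PRel (Oracle.ofLanguage (clLanguage r)) :=
  ⟨fun h r hr => (h r hr).2, fun h r hr => ⟨clLanguage_mem_NP r, h r hr⟩⟩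

end Literature.GroupTheory.CombinatorialGroupTheory

end
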